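import Summits.ValiantsHypothesis.ValiantsHypothesis.Theorems.PolyaContinuedMonotoneCoverHardLabelLevelled

/-!
# Crux `MonotoneCoverHard` (stmt-ValiantsHypothesis-7421), width line — LEVEL-FREE pure fibers:
**lanes carrying a fixed SET of ≥ 3 label-rows are impossible** (trio-as-a-set)

(val-width-7421-p4 g0, 2026-08-28; lane «width ≥ 3 at one level ⇒ non-Pfaffian», director's ask
"trio-as-a-set G2 variant".)

Level-free sibling of `false_of_pure_fiber` (`…PureFiber.lean`), obtained from the idle-split engine
(`no_pfaffian_cover_of_idleSplit`) with `P = ∅`: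

* `false_of_fiber_lanes` — let `τ₀` be a weight-nonzero perfect matching of a label-bijective Pfaffian
  cover of `per_n` with label permutation `σ₀`, `T` a set of `≥ 3` label-rows, and call the rows on
  which `τ₀` carries its `T`-labels the `T`-LANES of `τ₀`.  If every weight-nonzero perfect matching
  that carries the labels `x_{k σ₀ k}`, `k ∉ T`, carries its `T`-labels on `T`-lanes of `τ₀`, then
  `False`.  (Fiber substitution `x ↦ x` on `T × σ₀T`, `1` on `σ₀|Tᶜ`, `0` else; the non-lane rows become
  constant; one Schur step; Mignon–Ressayre.)
* `no_laneSet_pfaffian_cover` — **trio-as-a-set**: there is no label-bijective Pfaffian cover of `per_n`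
  with a set `R` of rows and a set `T` of `≥ 3` label-rows such that in EVERY weight-nonzero perfect
  matching the rows of `R` are exactly the rows carrying a variable with label-row in `T` (the
  assignment lane ↦ label-row may rotate from matching to matching).  This contains
  val-width-7421-p3's `no_threeHardLanes_pfaffian_cover` (fixed assignment, `#T = 3`) and
  `no_permanentTokens_pfaffian_cover` (`T` = all label-rows).

Column-vertex and label-column versions follow by transposing the cover / the labels
(`…Transpose.lean`).  VP ≠ VNP is not moved; `MonotoneCoverHard` stays open.  No definitions.
-/

namespace Summit.ValiantsHypothesis.ValiantsHypothesis.Theorems.PolyaContinuedMonotoneCoverHard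

-- summit = sub-problem name (single-conjunct summit, D-0017 layout), so the namespace repeats it
set_option linter.dupNamespace false

open scoped Classical
open Finset
open Literature.Computability.AlgebraicComplexity (perPoly)

/-- **Level-free pure fiber: `T`-lanes with `#T ≥ 3` are impossible.**  `τ₀` a weight-nonzero perfect
matching with label permutation `σ₀` (`hσ₀`), `T` a set of at least three label-rows; if every
weight-nonzero perfect matching carrying the labels `x_{k σ₀ k}` (`k ∉ T`) carries each of its labels
with label-row in `T` on a row where `τ₀` too carries a label with label-row in `T` (`hlanes`), then
`False`. -/
theorem false_of_fiber_lanes (n m : ℕ) (E : Finset (Fin m × Fin m))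
    (a : Fin m × Fin m → MvPolynomial (Fin n × Fin n) ℂ)
    (hsig : ∃ s : Fin m × Fin m → ℂ, (∀ e, s e = 1 ∨ s e = -1) ∧
      (Matrix.of fun i j => if (i, j) ∈ E then MvPolynomial.C (s (i, j)) * MvPolynomial.X (i, j)
          else 0 : Matrix (Fin m) (Fin m) (MvPolynomial (Fin m × Fin m) ℂ)).det =
        (Matrix.of fun i j => if (i, j) ∈ E then MvPolynomial.X (i, j) else 0 :
          Matrix (Fin m) (Fin m) (MvPolynomial (Fin m × Fin m) ℂ)).permanent)
    (ha : ∀ e, (∃ j, a e = MvPolynomial.X j) ∨ a e = 0 ∨ a e = 1)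
    (hper : perPoly (Fin n) ℂ =
      MvPolynomial.aeval a (Matrix.of fun i j => if (i, j) ∈ E then MvPolynomial.X (i, j) else 0 :
          Matrix (Fin m) (Fin m) (MvPolynomial (Fin m × Fin m) ℂ)).permanent)
    (τ₀ : Equiv.Perm (Fin m)) (hτ₀ : ∀ i, (i, τ₀ i) ∈ E ∧ a (i, τ₀ i) ≠ 0)
    (σ₀ : Equiv.Perm (Fin n)) (hσ₀ : ∀ i j, a (i, τ₀ i) = MvPolynomial.X j → σ₀ j.1 = j.2)
    (T : Finset (Fin n)) (hK3 : 3 ≤ T.card)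
    (hlanes : ∀ τ : Equiv.Perm (Fin m), (∀ i, (i, τ i) ∈ E ∧ a (i, τ i) ≠ 0) →
      (∀ k, k ∉ T → ∃ i, a (i, τ i) = MvPolynomial.X (k, σ₀ k)) →
      ∀ i (j : Fin n × Fin n), a (i, τ i) = MvPolynomial.X j → j.1 ∈ T →
        ∃ w : Fin n × Fin n, a (i, τ₀ i) = MvPolynomial.X w ∧ w.1 ∈ T) :
    False := by
  set f : Fin n × Fin n → MvPolynomial (Fin T.card × Fin T.card) ℂ := fun v =>
    if hk : v.1 ∈ T then
      (if hl : σ₀.symm v.2 ∈ T then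
        (MvPolynomial.X (T.equivFin ⟨v.1, hk⟩, T.equivFin ⟨σ₀.symm v.2, hl⟩) :
          MvPolynomial (Fin T.card × Fin T.card) ℂ)
      else 0)
    else if v.2 = σ₀ v.1 then 1 else 0 with hf
  set a' : Fin m × Fin m → MvPolynomial (Fin T.card × Fin T.card) ℂ :=
    fun e => MvPolynomial.aeval f (a e) with ha'def
  have ha'ap : ∀ e, a' e = MvPolynomial.aeval f (a e) := fun e => rfl
  have hX0 : ∀ j, (MvPolynomial.X j : MvPolynomial (Fin T.card × Fin T.card) ℂ) ≠ 0 :=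
    fun j => MvPolynomial.X_ne_zero j
  have hX1 : ∀ j, (MvPolynomial.X j : MvPolynomial (Fin T.card × Fin T.card) ℂ) ≠ 1 := by
    intro j h
    have h1 := congrArg MvPolynomial.totalDegree h
    rw [MvPolynomial.totalDegree_X, MvPolynomial.totalDegree_one] at h1
    exact one_ne_zero h1
  -- the four values of `f`
  have hfX : ∀ v : Fin n × Fin n, ∀ (hk : v.1 ∈ T) (hl : σ₀.symm v.2 ∈ T),
      f v = MvPolynomial.X (T.equivFin ⟨v.1, hk⟩, T.equivFin ⟨σ₀.symm v.2, hl⟩) := by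
    intro v hk hl
    rw [hf]
    simp only
    rw [dif_pos hk, dif_pos hl]
  have hf0 : ∀ v : Fin n × Fin n, v.1 ∈ T → σ₀.symm v.2 ∉ T → f v = 0 := by
    intro v hk hl
    rw [hf]
    simp only
    rw [dif_pos hk, dif_neg hl]
  have hf1 : ∀ v : Fin n × Fin n, v.1 ∉ T → v.2 = σ₀ v.1 → f v = 1 := by
    intro v hk hl
    rw [hf]
    simp only
    rw [dif_neg hk, if_pos hl]
  have hf0' : ∀ v : Fin n × Fin n, v.1 ∉ T → v.2 ≠ σ₀ v.1 → f v = 0 := by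
    intro v hk hl
    rw [hf]
    simp only
    rw [dif_neg hk, if_neg hl]
  have ha'X : ∀ e v, a e = MvPolynomial.X v → a' e = f v := by
    intro e v hv
    rw [ha'ap, hv, MvPolynomial.aeval_X]
  -- label shape of the substituted cover
  have ha' : ∀ e, (∃ j, a' e = MvPolynomial.X j) ∨ a' e = 0 ∨ a' e = 1 := by
    intro e
    rcases ha e with ⟨v, hv⟩ | h | h
    · rw [ha'X e v hv]
      by_cases hk : v.1 ∈ T
      · by_cases hl : σ₀.symm v.2 ∈ T
        · exact Or.inl ⟨_, hfX v hk hl⟩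
        · exact Or.inr (Or.inl (hf0 v hk hl))
      · by_cases hl : v.2 = σ₀ v.1
        · exact Or.inr (Or.inr (hf1 v hk hl))
        · exact Or.inr (Or.inl (hf0' v hk hl))
    · right; left
      rw [ha'ap, h, map_zero]
    · right; right
      rw [ha'ap, h, map_one]
  -- F1: a new variable label comes from an old variable label with label-row in `K`
  have hF1 : ∀ e j', a' e = MvPolynomial.X j' → ∃ v, a e = MvPolynomial.X v ∧ v.1 ∈ T := by
    intro e j' h
    rcases ha e with ⟨v, hv⟩ | h0 | h1
    · refine ⟨v, hv, ?_⟩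
      by_contra hk
      rw [ha'X e v hv] at h
      by_cases hl : v.2 = σ₀ v.1
      · rw [hf1 v hk hl] at h
        exact hX1 j' h.symm
      · rw [hf0' v hk hl] at h
        exact hX0 j' h.symm
    · exfalso
      rw [ha'ap, h0, map_zero] at h
      exact hX0 j' h.symm
    · exfalso
      rw [ha'ap, h1, map_one] at h
      exact hX1 j' h.symm
  -- F2: new-nonzero labels are old-nonzero
  have hF2 : ∀ e, a' e ≠ 0 → a e ≠ 0 := by
    intro e h h0
    apply h
    rw [ha'ap, h0, map_zero]
  -- F3: a new-good matching is old-good and carries the labels `x_{k σ₀ k}`, `k ∉ T`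
  have hF3 : ∀ τ : Equiv.Perm (Fin m), (∀ i, (i, τ i) ∈ E ∧ a' (i, τ i) ≠ 0) →
      (∀ i, (i, τ i) ∈ E ∧ a (i, τ i) ≠ 0) ∧
      (∀ k, k ∉ T → ∃ i, a (i, τ i) = MvPolynomial.X (k, σ₀ k)) := by
    intro τ hτ
    have hτold : ∀ i, (i, τ i) ∈ E ∧ a (i, τ i) ≠ 0 := fun i => ⟨(hτ i).1, hF2 _ (hτ i).2⟩
    refine ⟨hτold, fun k hk => ?_⟩
    obtain ⟨σ, -, hσ2⟩ := exists_perm_labels E a ha hper τ hτold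
    obtain ⟨i, hi, -⟩ := hσ2 k
    have hne := (hτ i).2
    rw [ha'X _ _ hi] at hne
    by_cases hl : σ k = σ₀ k
    · exact ⟨i, by rw [hi, hl]⟩
    · exact absurd (hf0' (k, σ k) hk hl) hne
  -- F5: `τ₀` is a weight-nonzero perfect matching of the substituted cover
  have hτ₀' : ∀ i, (i, τ₀ i) ∈ E ∧ a' (i, τ₀ i) ≠ 0 := by
    intro i
    refine ⟨(hτ₀ i).1, ?_⟩
    rcases ha (i, τ₀ i) with ⟨v, hv⟩ | h0 | h1
    · have hv2 : v.2 = σ₀ v.1 := (hσ₀ i v hv).symm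
      rw [ha'X _ _ hv]
      by_cases hk : v.1 ∈ T
      · have hl : σ₀.symm v.2 ∈ T := by rw [hv2, Equiv.symm_apply_apply]; exact hk
        rw [hfX v hk hl]
        exact hX0 _
      · rw [hf1 v hk hv2]
        exact one_ne_zero
    · exact absurd h0 (hτ₀ i).2
    · rw [ha'ap, h1, map_one]
      exact one_ne_zero
  -- the substituted cover computes `per_{#T}`
  have hper' : perPoly (Fin T.card) ℂ =
      MvPolynomial.aeval a' (Matrix.of fun i j => if (i, j) ∈ E then MvPolynomial.X (i, j) else 0 :
          Matrix (Fin m) (Fin m) (MvPolynomial (Fin m × Fin m) ℂ)).permanent := by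
    rw [← aeval_fiberSubst_perPoly T σ₀, hper, MvPolynomial.comp_aeval_apply]
  -- apply the idle-split engine with `U` = non-lane rows and `P = ∅`
  refine no_pfaffian_cover_of_idleSplit T.card m hK3 E a' hsig ha' hper' τ₀ hτ₀'
    (fun i => ¬ ∃ w : Fin n × Fin n, a (i, τ₀ i) = MvPolynomial.X w ∧ w.1 ∈ T)
    (fun _ => False) ?_ ?_ ?_ ?_ ?_ ?_
  · -- lane rows of `τ₀` are variable rows of the substituted cover
    intro i hU _
    obtain ⟨w, hw, hwT⟩ := not_not.1 hU
    have hw2 : w.2 = σ₀ w.1 := (hσ₀ i w hw).symm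
    have hl : σ₀.symm w.2 ∈ T := by rw [hw2, Equiv.symm_apply_apply]; exact hwT
    exact ⟨_, by rw [ha'X _ _ hw, hfX w hwT hl]⟩
  · -- non-lane rows have non-variable `τ₀`-edges
    intro i hU hv
    obtain ⟨k', hk'⟩ := hv
    obtain ⟨v, hv, hvT⟩ := hF1 _ _ hk'
    exact hU ⟨v, hv, hvT⟩
  · intro i hP; exact hP.elim
  · -- non-lane rows emit no used variable edge
    rintro i j hU ⟨τ, hτ, rfl⟩ ⟨k', hk'⟩
    obtain ⟨hτold, hagree⟩ := hF3 τ hτ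
    obtain ⟨v, hv, hvT⟩ := hF1 _ _ hk'
    exact hU (hlanes τ hτold hagree i v hv hvT)
  · intro i i' _ hP; exact hP.elim
  · intro i i' _ hP; exact hP.elim

/-- **Trio-as-a-set (lanes carrying a fixed set of ≥ 3 label-rows are impossible).**  There is no
label-bijective Pfaffian cover of `per_n` with a set `R` of rows and a set `T` of at least three
label-rows such that, in every weight-nonzero perfect matching, a row lies in `R` iff its edge carries a
variable with label-row in `T`. -/
theorem no_laneSet_pfaffian_cover (n m : ℕ) (E : Finset (Fin m × Fin m))
    (a : Fin m × Fin m → MvPolynomial (Fin n × Fin n) ℂ)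
    (hsig : ∃ s : Fin m × Fin m → ℂ, (∀ e, s e = 1 ∨ s e = -1) ∧
      (Matrix.of fun i j => if (i, j) ∈ E then MvPolynomial.C (s (i, j)) * MvPolynomial.X (i, j)
          else 0 : Matrix (Fin m) (Fin m) (MvPolynomial (Fin m × Fin m) ℂ)).det =
        (Matrix.of fun i j => if (i, j) ∈ E then MvPolynomial.X (i, j) else 0 :
          Matrix (Fin m) (Fin m) (MvPolynomial (Fin m × Fin m) ℂ)).permanent)
    (ha : ∀ e, (∃ j, a e = MvPolynomial.X j) ∨ a e = 0 ∨ a e = 1)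
    (hper : perPoly (Fin n) ℂ =
      MvPolynomial.aeval a (Matrix.of fun i j => if (i, j) ∈ E then MvPolynomial.X (i, j) else 0 :
          Matrix (Fin m) (Fin m) (MvPolynomial (Fin m × Fin m) ℂ)).permanent)
    (R : Finset (Fin m)) (T : Finset (Fin n)) (hT3 : 3 ≤ T.card)
    (hRT : ∀ τ : Equiv.Perm (Fin m), (∀ i, (i, τ i) ∈ E ∧ a (i, τ i) ≠ 0) → ∀ i,
      i ∈ R ↔ ∃ v : Fin n × Fin n, a (i, τ i) = MvPolynomial.X v ∧ v.1 ∈ T) : False := by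
  obtain ⟨τ₀, hτ₀, -⟩ := exists_good_of_perm E a ha hper 1
  obtain ⟨σ₀, hσ₀, -⟩ := exists_perm_labels E a ha hper τ₀ hτ₀
  refine false_of_fiber_lanes n m E a hsig ha hper τ₀ hτ₀ σ₀ hσ₀ T hT3 fun τ hτ _ i j hj hjT => ?_
  exact (hRT τ₀ hτ₀ i).1 ((hRT τ hτ i).2 ⟨j, hj, hjT⟩)

end Summit.ValiantsHypothesis.ValiantsHypothesis.Theorems.PolyaContinuedMonotoneCoverHard
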